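import Mathlib.RingTheory.PowerSeries.Substitution
import Mathlib.RingTheory.PowerSeries.Expand
import Mathlib.NumberTheory.Padics.RingHoms
import Mathlib.RingTheory.WittVector.FrobeniusFractionField
import Mathlib.RingTheory.WittVector.Compare
import Mathlib.FieldTheory.IsAlgClosed.AlgebraicClosure
import Literature.NumberTheory.EllipticCurves.PAdicLFunction
import Literature.NumberTheory.EllipticCurves.LFunctionPrimeCoeff
import Literature.NumberTheory.EllipticCurves.PAdicGrossZagierConstantTermProofs
import Literature.NumberTheory.EllipticCurves.Greenberg1999.TwoTorsionMuInvariant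
import Summits.BirchSwinnertonDyer.BirchSwinnertonDyer.Theorems.EisensteinDepletionAtTwoStarGO2KEtaTheoremKWittB
import Summits.BirchSwinnertonDyer.BirchSwinnertonDyer.Theorems.EisensteinDepletionAtTwoStarGO2KEtaTheoremKPadicB
import Summits.BirchSwinnertonDyer.BirchSwinnertonDyer.Theorems.EisensteinDepletionAtTwoStarGO2KEtaLineAdapter
import Summits.BirchSwinnertonDyer.BirchSwinnertonDyer.Theorems.EisensteinDepletionAtTwoStarGO2KEtaHondaPointPattern
import Summits.BirchSwinnertonDyer.BirchSwinnertonDyer.Theorems.EisensteinDepletionAtTwoStarOptBNSFKummerAlg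
import HarnessLib

/-!
# THEOREM K AT THE HONDA POINT — the `2`-adic Kummer class law `KummerClassLawAtTwo` (KEtaHondaPoint, part 10b)
(crux `StarGO2Sigma`, stmt-BirchSwinnertonDyer-27046; line kummer, research stub `stub_discrepancyCover`;
also E1M_NSF stmt-27021 — the CLASS side of (★))

Planner bsd-rank2-p2 GEN 38.  THEOREM K (parts 1–9) gives, for every `z ∈ X𝕎(k)⟦X⟧`, the Kummer class of
`g∘z = z²(x(z) − x₀)` as `δ̄ = (ḡ∘z̄)²·(S(λ̄)∘z̄ + (ω̄∘z̄)² d̄_z)` — explicit but with the awkward `(ω̄∘z̄)²d̄_z`.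
HERE we evaluate it AT THE HONDA POINT `Z_c = exp_W(c·ℓ)`, `ℓ = Σ aₙ(W) qⁿ/n` (the modular parametrisation of
the formal group; `Z_c ∈ ℤ⟦q⟧` by the tree's `ParamIntegral`), where the class collapses to a pure
`L`-SERIES PATTERN:

* §A `exists_artinSchreier_witness_subst` — GEN 36 Lemma 2 applied to `a = c₀·log_W(z_K)` directly:
  `φ(F₀∘z) = (F₀∘z)²(1 + 2t)`, `t̄ − t̄² = M̄`, where `M ∈ ℤ₂⟦q⟧` lifts `λ_α(log_W ∘ Z) = (log_W∘Z) − (α/2)(log_W∘Z)(q²)`;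
* §B `theoremK_subst` — with `theoremK_witt`: `δ̄_{g∘z} = (ḡ∘z̄)²·t̄` (no `ω`, no `d_z`);
* §C `classLaw_padicInt_subst` — descent `𝕎(𝔽̄₂) ⇝ ℤ₂/𝔽₂`: `δ̄ = (ḡ∘Z̄)²·asRoot(M̄)`;
* §D `kummerClassLaw_hondaPoint` — at `Z = Z_c`: `log_W∘Z_c = c·ℓ`, `M = c·Λ_ℓ`, `Λ̄_ℓ = Σ ā_{n′}qⁿ` (Hecke at `2`,
  part 10a), `asRoot(c̄Λ̄_ℓ) = c̄·Σ_{v₂(n) even} ā_{n′}qⁿ = c̄·Ḡ`; hence with `U = Z_c²(x_W(Z_c) − x₀) ∈ ℤ⟦q⟧`: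
  **`U² − U(q²)·(1 + 2c·G) ∈ 4ℤ⟦q⟧`**, `G = Σ_{v₂(n) even} a_{n′}(W) qⁿ` — the typed target shape
  `KEta.KummerClassLawAtTwo` of GEN 36 (HOME/p2/g36/lean/KEtaLaw.lean), for EVERY `W/ℚ` globally minimal and
  ordinary at `2` with a rational `2`-torsion abscissa `x₀ ∈ ℤ` (resp. `x₀ ∈ ℚ`, `v₂(x₀) ≥ 0`, which forces `x₀ ∈ ℤ`:
  `exists_int_eq_of_twoTorsionX`), and every multiplier `c ∈ ℤ`.
Nothing here reads `r_an`; `StarGO2Sigma` / E1M / BSD are NOT proved by this file.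
-/

set_option linter.dupNamespace false
set_option linter.unusedSectionVars false
set_option autoImplicit false

noncomputable section

namespace Summit.BirchSwinnertonDyer.BirchSwinnertonDyer.Theorems.DepletionAtTwo.KEta.HondaPoint

open PowerSeries Literature.RingTheory.FormalGroups Literature.NumberTheory.EllipticCurves

/-! ## §A The Artin–Schreier class of `F₀ ∘ z` for an integral substitution `z = ι_* Z`, `Z ∈ Xℤ₂⟦X⟧` -/

/-- `M(0) = 0` for a lift `M` of `λ_α(log_W ∘ Z)`. -/
theorem constantCoeff_eq_zero_of_map_eq_frobLambda (W : WeierstrassCurve ℤ) (α : ℚ_[2])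
    {Z M : PowerSeries ℤ_[2]} (hZ0 : constantCoeff Z = 0)
    (hM : M.map (PadicInt.Coe.ringHom (p := 2)) =
      HondaLambda.frobLambda α
        (((W.map (Int.castRingHom ℚ_[2])).formalLog).subst (Z.map (PadicInt.Coe.ringHom (p := 2))))) :
    constantCoeff M = 0 := by
  have hZ₂0 : constantCoeff (Z.map (PadicInt.Coe.ringHom (p := 2))) = 0 := by
    rw [KummerAlg.constantCoeff_map', hZ0, map_zero]
  have h : ((constantCoeff M : ℤ_[2]) : ℚ_[2]) = 0 := by
    have h1 := congrArg constantCoeff hM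
    rw [KummerAlg.constantCoeff_map', HondaLambda.constantCoeff_frobLambda
      (by rw [Kernel.constantCoeff_subst_of_constantCoeff_eq_zero hZ₂0, WeierstrassCurve.constantCoeff_formalLog])] at h1
    exact h1
  exact (PadicInt.coe_eq_zero).mp h

section Witt

variable (k : Type*) [Field k] [IsAlgClosed k] [CharP k 2] [Algebra ℚ (FractionRing (WittVector 2 k))]

/-- **The Artin–Schreier class of `F₀ ∘ z`** for `z = ι_*Z`, `Z ∈ Xℤ₂⟦X⟧`: there is `t ∈ 𝕎(k)⟦X⟧` with
`φ(F₀∘z) = (F₀∘z)²(1 + 2t)`, `t(0) = 0`, `t̄ − t̄² = M̄`, `M ∈ ℤ₂⟦X⟧` any lift of `λ_α(log_W∘Z)`.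
(GEN 36 Lemma 2 `ExpClass.frob_exp_class` applied to `a = c₀·(log_W∘z_K)`; the defect is `c₀·j_*λ_α(log_W∘Z)`
because `σ_K` fixes `z_K` and `log_W`, and `σ_K c₀ = α c₀`.) -/
theorem exists_artinSchreier_witness_subst (W : WeierstrassCurve ℤ) (a : ℤ) {α : ℤ_[2]} (hαn : ‖α‖ = 1)
    (hroot : (α : ℚ_[2]) ^ 2 - a * α + 2 = 0)
    (hH : ∀ n, ‖coeff n (hondaShift 2 (a : ℚ_[2]) (W.map (Int.castRingHom ℚ_[2])).formalLog)‖ ≤ 1)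
    {Z M : PowerSeries ℤ_[2]} (hZ0 : constantCoeff Z = 0)
    (hM : M.map (PadicInt.Coe.ringHom (p := 2)) =
      HondaLambda.frobLambda (α : ℚ_[2])
        (((W.map (Int.castRingHom ℚ_[2])).formalLog).subst (Z.map (PadicInt.Coe.ringHom (p := 2))))) :
    ∃ t : PowerSeries (WittVector 2 k),
      Kernel.phi (WittVector.frobenius : WittVector 2 k →+* WittVector 2 k)
          ((TheoremKWitt.compFn k W a hαn hroot hH).subst (Z.map (WittExistence.iota k))) =
        (TheoremKWitt.compFn k W a hαn hroot hH).subst (Z.map (WittExistence.iota k)) ^ 2 +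
          2 * ((TheoremKWitt.compFn k W a hαn hroot hH).subst (Z.map (WittExistence.iota k)) ^ 2 * t) ∧
      constantCoeff t = 0 ∧
      PowerSeries.map (WittVector.constantCoeff : WittVector 2 k →+* k) t -
          PowerSeries.map (WittVector.constantCoeff : WittVector 2 k →+* k) t ^ 2 =
        M.map ((WittVector.constantCoeff : WittVector 2 k →+* k).comp (WittExistence.iota k)) := by
  obtain ⟨h2r, hker, hfrob⟩ := Kernel.frobeniusLift_wittVector k
  have hαu : IsUnit α := PadicInt.isUnit_iff.mpr hαn
  set ι : ℤ_[2] →+* WittVector 2 k := WittExistence.iota k with hιdef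
  set ιK := algebraMap (WittVector 2 k) (FractionRing (WittVector 2 k)) with hιK
  have hιKi : Function.Injective ιK := IsFractionRing.injective _ _
  set σK := WittExistence.fracFrobenius k with hσK
  set c₀ := WittExistence.period (k := k) hαu with hc₀
  set F₀ := TheoremKWitt.compFn k W a hαn hroot hH with hF₀
  set LK := (W.map (Int.castRingHom (FractionRing (WittVector 2 k)))).formalLog with hLK
  set L₂ := (W.map (Int.castRingHom ℚ_[2])).formalLog with hL₂
  set Z₂ : PowerSeries ℚ_[2] := Z.map (PadicInt.Coe.ringHom (p := 2)) with hZ₂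
  set z : PowerSeries (WittVector 2 k) := Z.map ι with hz
  set zK : PowerSeries (FractionRing (WittVector 2 k)) := z.map ιK with hzK
  have hM0 : constantCoeff M = 0 := constantCoeff_eq_zero_of_map_eq_frobLambda W _ hZ0 hM
  have hz0 : constantCoeff z = 0 := by rw [hz, KummerAlg.constantCoeff_map', hZ0, map_zero]
  have hzK0 : constantCoeff zK = 0 := by rw [hzK, KummerAlg.constantCoeff_map', hz0, map_zero]
  have hZ₂0 : constantCoeff Z₂ = 0 := by rw [hZ₂, KummerAlg.constantCoeff_map', hZ0, map_zero]
  have hzs : HasSubst z := HasSubst.of_constantCoeff_zero' hz0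
  have hzKs : HasSubst zK := HasSubst.of_constantCoeff_zero' hzK0
  have hZ₂s : HasSubst Z₂ := HasSubst.of_constantCoeff_zero' hZ₂0
  set aK : PowerSeries (FractionRing (WittVector 2 k)) := C (ιK c₀) * LK with haK
  set aKz : PowerSeries (FractionRing (WittVector 2 k)) := C (ιK c₀) * LK.subst zK with haKz
  set w : PowerSeries (FractionRing (WittVector 2 k)) :=
    aKz - (2 : ℚ)⁻¹ • expand 2 two_ne_zero (PowerSeries.map σK aKz) with hw
  have hc : WittVector.constantCoeff c₀ = 1 := by
    rw [WittVector.constantCoeff_apply]; exact WittExistence.coeff_zero_period _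
  have hLK0 : constantCoeff LK = 0 := WeierstrassCurve.constantCoeff_formalLog _
  have haK0 : constantCoeff aK = 0 := by rw [haK, map_mul, hLK0, mul_zero]
  have haKs : HasSubst aK := HasSubst.of_constantCoeff_zero' haK0
  have ha0 : constantCoeff aKz = 0 := by
    rw [haKz, map_mul, Kernel.constantCoeff_subst_of_constantCoeff_eq_zero hzK0 LK, hLK0, mul_zero]
  -- (i) `σ_K` fixes `ι_K ι` and twists `c₀` by `α`
  have hσι : ∀ x : ℤ_[2], σK (ιK (ι x)) = ιK (ι x) := fun x => by
    rw [hσK, hιK, hιdef, WittExistence.fracFrobenius_algebraMap, WittExistence.frobenius_iota]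
  have hσc : σK (ιK c₀) = ιK c₀ * ιK (ι α) := by
    rw [hσK, hιK, hc₀, hιdef, WittExistence.fracFrobenius_algebraMap, WittExistence.frobenius_period, map_mul]
  have hια : ιK (ι α) = WittExistence.jmap k (α : ℚ_[2]) := by
    rw [hιK, hιdef, WittExistence.jmap_coe]
  -- (ii) `z_K` and `log ∘ z_K` are `σ_K`-fixed
  have hcoeff_zK : ∀ m, coeff m zK = ιK (ι (coeff m Z)) := fun m => by rw [hzK, hz, coeff_map, coeff_map]
  have hzKfix : zK.map σK = zK := by ext m; rw [coeff_map, hcoeff_zK, hσι]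
  have hLKfix : LK.map σK = LK := by rw [hLK, hσK]; exact WittExistence.formalLog_map_fracFrobenius k W
  have hGfix : PowerSeries.map σK (LK.subst zK) = LK.subst zK := by
    rw [Kernel.map_subst_apply' hzKs σK LK, hzKfix, hLKfix]
  -- (iii) `log ∘ z_K = j_*(log ∘ Z₂)`
  have hZj : Z₂.map (WittExistence.jmap k) = zK := by
    ext m
    rw [coeff_map, hcoeff_zK, hZ₂, coeff_map]
    exact WittExistence.jmap_coe k (coeff m Z)
  have hGK : PowerSeries.map (WittExistence.jmap k) (L₂.subst Z₂) = LK.subst zK := by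
    rw [Kernel.map_subst_apply' hZ₂s (WittExistence.jmap k) L₂, hZj, hL₂, WittExistence.formalLog_map_jmap, ← hLK]
  have hGj : ∀ m, coeff m (LK.subst zK) = WittExistence.jmap k (coeff m (L₂.subst Z₂)) := fun m => by
    rw [← hGK, coeff_map]
  -- (iv) `σ_{K,*} a`
  have haKzσ : aKz.map σK = C (ιK c₀ * ιK (ι α)) * LK.subst zK := by
    rw [haKz, map_mul, map_C, hσc, hGfix]
  -- (v) the defect `w = a − ½·expand₂(σ_* a)` coefficientwise: `c₀ · ι(M)`
  have h2 : ((2 : ℚ)⁻¹ : ℚ) • (1 : FractionRing (WittVector 2 k)) =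
      (2 : FractionRing (WittVector 2 k))⁻¹ := by
    rw [Algebra.smul_def, mul_one, map_inv₀, map_ofNat]
  have hMj : ∀ m, ιK (ι (coeff m M)) =
      WittExistence.jmap k (coeff m (HondaLambda.frobLambda (α : ℚ_[2]) (L₂.subst Z₂))) := fun m => by
    rw [← hM, coeff_map, hιK, hιdef, ← WittExistence.jmap_coe]
    rfl
  have hw_coeff : ∀ m, coeff m w = ιK (c₀ * ι (coeff m M)) := fun m => by
    rw [map_mul, hMj, HondaLambda.coeff_frobLambda, hw, map_sub, coeff_smul, coeff_expand, haKzσ, haKz,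
      coeff_C_mul, coeff_C_mul]
    by_cases h2m : 2 ∣ m
    · rw [if_pos h2m, if_pos h2m, map_sub, map_mul, map_div₀, map_natCast, ← hGj, ← hGj, ← hια,
        ← smul_one_mul ((2 : ℚ)⁻¹), h2, Nat.cast_ofNat]
      ring
    · rw [if_neg h2m, if_neg h2m, mul_zero, sub_zero, ← hGj]
      simp
  have hwO : w = PowerSeries.map ιK (C c₀ * PowerSeries.map ι M) := by
    ext m; rw [hw_coeff, coeff_map, coeff_C_mul, coeff_map]
  have hw0 : constantCoeff w = 0 := by
    rw [← coeff_zero_eq_constantCoeff_apply, hw_coeff, coeff_zero_eq_constantCoeff_apply, hM0, map_zero,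
      mul_zero, map_zero]
  have hwA : ∀ m, coeff m w ∈ WittExistence.intRange k := fun m => by
    rw [hw_coeff]; exact WittExistence.algebraMap_mem_intRange k _
  have hy : expand 2 two_ne_zero (aKz.map σK) = 2 * aKz - 2 * w :=
    ExpClass.expand_map_eq_of_sub_smul σK aKz
  obtain ⟨s, hsA, hE, hcl⟩ := ExpClass.frob_exp_class (WittExistence.intRange k) σK
    (WittExistence.hA k) ha0 hw0 hwA hy
  -- descend `s`
  choose sc hsc using fun m => (WittExistence.mem_intRange_iff k).mp (hsA m)
  set t : PowerSeries (WittVector 2 k) := PowerSeries.mk sc with ht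
  have htK : PowerSeries.map ιK t = s := by ext m; rw [coeff_map, ht, coeff_mk, hsc]
  -- `ι_{K,*}(F₀ ∘ z) = exp(a)`
  have hmapF : PowerSeries.map ιK F₀ = (exp (FractionRing (WittVector 2 k))).subst aK :=
    TheoremKWitt.map_compFn k W a hαn hroot hH
  have haKsub : aK.subst zK = aKz := by
    rw [haK, haKz, ← smul_eq_C_mul, ← smul_eq_C_mul, subst_smul hzKs]
  have hFK : PowerSeries.map ιK (F₀.subst z) = (exp (FractionRing (WittVector 2 k))).subst aKz := by
    rw [Kernel.map_subst_apply' hzs ιK F₀, hmapF, ← hzK, subst_comp_subst_apply haKs hzKs, haKsub]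
  have hcomp : ιK.comp (WittVector.frobenius : WittVector 2 k →+* WittVector 2 k) = σK.comp ιK := by
    ext x; exact (WittExistence.fracFrobenius_algebraMap k x).symm
  have hδF : Kernel.phi (WittVector.frobenius : WittVector 2 k →+* WittVector 2 k) (F₀.subst z) =
      F₀.subst z ^ 2 + 2 * (F₀.subst z ^ 2 * t) := by
    apply PowerSeries.map_injective ιK hιKi
    rw [Kernel.phi_def, map_expand, Kernel.map_map_apply', hcomp, ← Kernel.map_map_apply', hFK,
      hE, map_add, map_mul, map_mul, map_pow, map_ofNat, hFK, htK]
    ring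
  refine ⟨t, hδF, ?_, ?_⟩
  · -- `t(0) = 0`: constant terms of `φ(F₀∘z) = (F₀∘z)²(1 + 2t)`, `(F₀∘z)(0) = 1`
    have hF0 : constantCoeff F₀ = 1 :=
      ExpSide.constantCoeff_eq_one_of_map ιK hιKi _ (TheoremKWitt.map_compFn_eq_expLog k W a hαn hroot hH)
    have hFz0 : constantCoeff (F₀.subst z) = 1 := by
      rw [Kernel.constantCoeff_subst_of_constantCoeff_eq_zero hz0 F₀, hF0]
    have h := congrArg constantCoeff hδF
    rw [Kernel.constantCoeff_phi, map_add, map_mul, map_mul, map_pow, hFz0, map_one, one_pow, one_mul,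
      map_ofNat, left_eq_add] at h
    exact h2r _ h
  · -- `t̄ − t̄² = M̄`
    have h2k : (2 : k) = 0 := by
      have h := CharP.cast_eq_zero k 2
      simpa using h
    ext n
    obtain ⟨b, hb, hbn⟩ := hcl n
    obtain ⟨bO, rfl⟩ := (WittExistence.mem_intRange_iff k).mp hb
    have hn : coeff n (t - t ^ 2 - C c₀ * PowerSeries.map ι M) = 2 * bO := by
      apply hιKi
      rw [← coeff_map, map_sub (PowerSeries.map ιK), map_sub (PowerSeries.map ιK),
        map_pow (PowerSeries.map ιK), ← hwO, htK, hbn, map_mul ιK, map_ofNat ιK]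
    have hπ : (WittVector.constantCoeff : WittVector 2 k →+* k)
        (coeff n (t - t ^ 2 - C c₀ * PowerSeries.map ι M)) = 0 := by
      rw [hn, map_mul, map_ofNat, h2k, zero_mul]
    rw [← coeff_map, map_sub (PowerSeries.map (WittVector.constantCoeff : WittVector 2 k →+* k)),
      map_sub (PowerSeries.map (WittVector.constantCoeff : WittVector 2 k →+* k)),
      map_pow (PowerSeries.map (WittVector.constantCoeff : WittVector 2 k →+* k)),
      map_mul (PowerSeries.map (WittVector.constantCoeff : WittVector 2 k →+* k)), map_C, hc, map_one,
      one_mul, Kernel.map_map_apply',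
      map_sub (coeff n) (PowerSeries.map (WittVector.constantCoeff : WittVector 2 k →+* k) t -
        PowerSeries.map (WittVector.constantCoeff : WittVector 2 k →+* k) t ^ 2), sub_eq_zero] at hπ
    rw [hπ]

/-! ## §B THEOREM K for the substituted composite: `δ̄_{g∘z} = (ḡ∘z̄)² · t̄` -/

/-- **THEOREM K along an integral substitution** (`𝕎(k)` level).  Curve-side hypotheses as
`theoremK_explicit` (`hH`, unit root, integral `2`-torsion abscissa `x₀ ∈ 𝕎(k)`, `ā₁ = 1`); `Z ∈ Xℤ₂⟦X⟧`,
`M` a lift of `λ_α(log_W∘Z)`.  THEN there is `t̄ ∈ k⟦X⟧`, `t̄(0) = 0`, `t̄ − t̄² = M̄`, with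
`δ̄ = (ḡ∘z̄)²·t̄` for every Dwork witness `δ` of `g∘z`, `g = X²(x(X) − x₀)`, `z = ι_*Z`. -/
theorem theoremK_subst (W : WeierstrassCurve ℤ) (a : ℤ) {α : ℤ_[2]} (hαn : ‖α‖ = 1)
    (hroot : (α : ℚ_[2]) ^ 2 - a * α + 2 = 0)
    (hH : ∀ n, ‖coeff n (hondaShift 2 (a : ℚ_[2]) (W.map (Int.castRingHom ℚ_[2])).formalLog)‖ ≤ 1)
    {x₀ : WittVector 2 k}
    (hx : 4 * x₀ ^ 3 + (W.map (Int.castRingHom (WittVector 2 k))).b₂ * x₀ ^ 2 +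
      2 * (W.map (Int.castRingHom (WittVector 2 k))).b₄ * x₀ +
        (W.map (Int.castRingHom (WittVector 2 k))).b₆ = 0)
    (ha1 : WittVector.constantCoeff (W.map (Int.castRingHom (WittVector 2 k))).a₁ = 1)
    {Z M : PowerSeries ℤ_[2]} (hZ0 : constantCoeff Z = 0)
    (hM : M.map (PadicInt.Coe.ringHom (p := 2)) =
      HondaLambda.frobLambda (α : ℚ_[2])
        (((W.map (Int.castRingHom ℚ_[2])).formalLog).subst (Z.map (PadicInt.Coe.ringHom (p := 2))))) :
    ∃ tbar : PowerSeries k, constantCoeff tbar = 0 ∧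
      tbar - tbar ^ 2 = M.map ((WittVector.constantCoeff : WittVector 2 k →+* k).comp (WittExistence.iota k)) ∧
      ∀ δgz : PowerSeries (WittVector 2 k),
        Kernel.phi (WittVector.frobenius : WittVector 2 k →+* WittVector 2 k)
            (((W.map (Int.castRingHom (WittVector 2 k))).formalXMulSq - C x₀ * X ^ 2).subst
              (Z.map (WittExistence.iota k))) =
          (((W.map (Int.castRingHom (WittVector 2 k))).formalXMulSq - C x₀ * X ^ 2).subst
              (Z.map (WittExistence.iota k))) ^ 2 + 2 * δgz →
        PowerSeries.map (WittVector.constantCoeff : WittVector 2 k →+* k) δgz =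
          (PowerSeries.map (WittVector.constantCoeff : WittVector 2 k →+* k)
              (((W.map (Int.castRingHom (WittVector 2 k))).formalXMulSq - C x₀ * X ^ 2).subst
                (Z.map (WittExistence.iota k)))) ^ 2 * tbar := by
  obtain ⟨h2r, hker, hfrob⟩ := Kernel.frobeniusLift_wittVector k
  obtain ⟨tO, hδF, ht0, hAS⟩ := exists_artinSchreier_witness_subst k W a hαn hroot hH hZ0 hM
  set π : WittVector 2 k →+* k := WittVector.constantCoeff with hπdef
  set F₀ := TheoremKWitt.compFn k W a hαn hroot hH with hF₀
  set z : PowerSeries (WittVector 2 k) := Z.map (WittExistence.iota k) with hz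
  have h2 := TheoremKWitt.map_formalMul_two_ne_zero π (W.map (Int.castRingHom (WittVector 2 k))) ha1
  have hx0 := TheoremKWitt.constantCoeff_eq_of_twoTorsionX π (W.map (Int.castRingHom (WittVector 2 k))) hx ha1
  obtain ⟨B, hB⟩ := TheoremKWitt.exists_half hker (W.map (Int.castRingHom (WittVector 2 k))) ha1 hx0
  have hz0 : constantCoeff z = 0 := by rw [hz, KummerAlg.constantCoeff_map', hZ0, map_zero]
  refine ⟨PowerSeries.map π tO, ?_, hAS, fun δgz hgz => ?_⟩
  · rw [KummerAlg.constantCoeff_map', ht0, map_zero]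
  have TK := TheoremKWitt.theoremK_witt k W a hαn hroot hH hx hB ha1 hx0 h2 hz0 hgz hδF
  -- cancel `(F̄₀∘z̄)²`
  have hιKi : Function.Injective (algebraMap (WittVector 2 k) (FractionRing (WittVector 2 k))) :=
    IsFractionRing.injective _ _
  have hF0 : constantCoeff F₀ = 1 :=
    ExpSide.constantCoeff_eq_one_of_map _ hιKi _ (TheoremKWitt.map_compFn_eq_expLog k W a hαn hroot hH)
  have hFzne : PowerSeries.map π (F₀.subst z) ≠ 0 := by
    intro h0
    have h1 := congrArg constantCoeff h0
    rw [KummerAlg.constantCoeff_map', Kernel.constantCoeff_subst_of_constantCoeff_eq_zero hz0 F₀, hF0,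
      map_one, map_zero] at h1
    exact one_ne_zero h1
  have hF2ne : PowerSeries.map π (F₀.subst z) ^ 2 ≠ 0 := pow_ne_zero 2 hFzne
  apply mul_right_cancel₀ hF2ne
  rw [TK, map_mul, map_pow]
  ring

end Witt

/-! ## §C Descent to `ℤ₂ / 𝔽₂` -/

/-- **THEOREM K along an integral substitution, `ℤ₂/𝔽₂` form.**  `W/ℤ`, `hH`, unit root `α`, an integral
`2`-adic `2`-torsion abscissa `x₀ ∈ ℤ₂`, `a₁` odd; `Z ∈ Xℤ₂⟦X⟧`, `M ∈ ℤ₂⟦X⟧` lifting `λ_α(log_W ∘ Z)`.  THEN the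
Dwork witness `δ` of `g∘Z` (`(g∘Z)(q²) = (g∘Z)² + 2δ`, `g = X²(x(X) − x₀)`) satisfies
`δ̄ = (ḡ∘Z̄)² · asRoot(M̄)` in `𝔽₂⟦q⟧`, `asRoot(M̄) = Σ_j M̄^{2^j}`. -/
theorem classLaw_padicInt_subst (W : WeierstrassCurve ℤ) (a : ℤ) {α : ℤ_[2]} (hαn : ‖α‖ = 1)
    (hroot : (α : ℚ_[2]) ^ 2 - a * α + 2 = 0)
    (hH : ∀ n, ‖coeff n (hondaShift 2 (a : ℚ_[2]) (W.map (Int.castRingHom ℚ_[2])).formalLog)‖ ≤ 1)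
    {x₀ : ℤ_[2]}
    (hx : 4 * x₀ ^ 3 + (W.map (Int.castRingHom ℤ_[2])).b₂ * x₀ ^ 2 +
      2 * (W.map (Int.castRingHom ℤ_[2])).b₄ * x₀ + (W.map (Int.castRingHom ℤ_[2])).b₆ = 0)
    (ha1 : Odd W.a₁) {Z M : PowerSeries ℤ_[2]} (hZ0 : constantCoeff Z = 0)
    (hM : M.map (PadicInt.Coe.ringHom (p := 2)) =
      HondaLambda.frobLambda (α : ℚ_[2])
        (((W.map (Int.castRingHom ℚ_[2])).formalLog).subst (Z.map (PadicInt.Coe.ringHom (p := 2)))))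
    {δ : PowerSeries ℤ_[2]}
    (hδ : Kernel.phi (RingHom.id ℤ_[2])
        (((W.map (Int.castRingHom ℤ_[2])).formalXMulSq - C x₀ * X ^ 2).subst Z) =
      (((W.map (Int.castRingHom ℤ_[2])).formalXMulSq - C x₀ * X ^ 2).subst Z) ^ 2 + 2 * δ) :
    δ.map (PadicInt.toZMod (p := 2)) =
      (PowerSeries.map (PadicInt.toZMod (p := 2))
          (((W.map (Int.castRingHom ℤ_[2])).formalXMulSq - C x₀ * X ^ 2).subst Z)) ^ 2 *
        ArtinSchreier.asRoot (M.map (PadicInt.toZMod (p := 2))) := by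
  let k := AlgebraicClosure (ZMod 2)
  haveI : CharZero (FractionRing (WittVector 2 k)) := WittExistence.charZero_fractionRing k
  set ρ : ℤ_[2] →+* ZMod 2 := PadicInt.toZMod (p := 2) with hρ
  set θ : ZMod 2 →+* k := ZMod.castHom (dvd_refl 2) k with hθ
  set ι : ℤ_[2] →+* WittVector 2 k := WittExistence.iota k with hι
  set π : WittVector 2 k →+* k := WittVector.constantCoeff with hπ
  have hθi : Function.Injective θ := θ.injective
  set W₂ := W.map (Int.castRingHom ℤ_[2]) with hW₂
  set WO := W.map (Int.castRingHom (WittVector 2 k)) with hWO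
  have hWmap : W₂.map ι = WO := TheoremKPadic.map_iota_weierstrass k W
  have hM0 : constantCoeff M = 0 := constantCoeff_eq_zero_of_map_eq_frobLambda W _ hZ0 hM
  have hMρ0 : constantCoeff (M.map ρ) = 0 := by rw [KummerAlg.constantCoeff_map', hM0, map_zero]
  -- hypotheses over `𝕎(k)`
  have hx' : 4 * ι x₀ ^ 3 + WO.b₂ * ι x₀ ^ 2 + 2 * WO.b₄ * ι x₀ + WO.b₆ = 0 := by
    have h := congrArg ι hx
    rw [← hWmap]
    simp only [map_add, map_mul, map_pow, map_ofNat, map_zero, WeierstrassCurve.map_b₂,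
      WeierstrassCurve.map_b₄, WeierstrassCurve.map_b₆] at h ⊢
    exact h
  have ha1' : π WO.a₁ = 1 := by
    obtain ⟨m, hm⟩ := ha1
    have h2k : (2 : k) = 0 := CharTwo.two_eq_zero
    rw [hWO, WeierstrassCurve.map_a₁, eq_intCast, map_intCast, hm, Int.cast_add, Int.cast_mul, Int.cast_ofNat,
      Int.cast_one, h2k, zero_mul, zero_add]
  have hZs : HasSubst Z := HasSubst.of_constantCoeff_zero' hZ0
  have hg : (W₂.formalXMulSq - C x₀ * X ^ 2).map ι = WO.formalXMulSq - C (ι x₀) * X ^ 2 := by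
    rw [map_sub, WeierstrassCurve.map_formalXMulSq, hWmap, map_mul, map_C, map_pow, map_X]
  have hgsub : PowerSeries.map ι ((W₂.formalXMulSq - C x₀ * X ^ 2).subst Z) =
      (WO.formalXMulSq - C (ι x₀) * X ^ 2).subst (Z.map ι) := by
    rw [Kernel.map_subst_apply' hZs, hg]
  have hδ' : Kernel.phi (WittVector.frobenius : WittVector 2 k →+* WittVector 2 k)
      ((WO.formalXMulSq - C (ι x₀) * X ^ 2).subst (Z.map ι)) =
      (WO.formalXMulSq - C (ι x₀) * X ^ 2).subst (Z.map ι) ^ 2 + 2 * δ.map ι := by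
    rw [← hgsub, ← TheoremKPadic.map_iota_phi, hδ, map_add, map_pow, map_mul, map_ofNat]
  -- THEOREM K over `𝕎(k)` along `Z`
  obtain ⟨tk, htk0, htkAS, H⟩ := theoremK_subst k W a hαn hroot hH hx' ha1' hZ0 hM
  have H1 := H (δ.map ι) hδ'
  -- identify `tk` with the image of the `𝔽₂`-root
  have hMk : M.map (π.comp ι) = (M.map ρ).map θ := by
    rw [← Kernel.map_map_apply', TheoremKPadic.map_iota_map_constantCoeff]
  have htk : tk = (ArtinSchreier.asRoot (M.map ρ)).map θ := by
    refine ArtinSchreier.as_unique htkAS ?_ htk0 ?_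
    · rw [← map_pow, ← map_sub, ArtinSchreier.asRoot_spec hMρ0, ← hMk]
    · rw [KummerAlg.constantCoeff_map', ArtinSchreier.constantCoeff_asRoot hMρ0, map_zero]
  have e_δ : (δ.map ι).map π = (δ.map ρ).map θ := TheoremKPadic.map_iota_map_constantCoeff k δ
  have e_g : PowerSeries.map π ((WO.formalXMulSq - C (ι x₀) * X ^ 2).subst (Z.map ι)) =
      (PowerSeries.map ρ ((W₂.formalXMulSq - C x₀ * X ^ 2).subst Z)).map θ := by
    rw [← hgsub, TheoremKPadic.map_iota_map_constantCoeff]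
  rw [e_δ, e_g, htk, ← map_pow, ← map_mul] at H1
  exact PowerSeries.map_injective θ hθi H1

end Summit.BirchSwinnertonDyer.BirchSwinnertonDyer.Theorems.DepletionAtTwo.KEta.HondaPoint
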